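import Summits.MatrixMultiplication.OmegaCensus.STPPVosperPrimeTableLaw
import Summits.MatrixMultiplication.OmegaCensus.STPPVosperTilingLaw
import Summits.MatrixMultiplication.OmegaCensus.STPPVosperSlackOneLawMult
import Summits.MatrixMultiplication.OmegaCensus.STPPHamidouneRodsethInverseTheorem
import Summits.MatrixMultiplication.OmegaCensus.STPP222SqSymmetry
import Summits.MatrixMultiplication.OmegaCensus.STPPDisjointPacking
import Summits.MatrixMultiplication.OmegaCensus.STPPKernelListerOrderN47DP5

/-!
# ω-census (abelian STPP census): **ℤ₄₇ admits no beating STPP family — KERNEL, UNCONDITIONAL** (the three tree-law survivors killed by Vosper laws + the order-47 lister capstone)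

HONEST FRAMING (pub-omega census; verbatim): lottery ticket; floor = certified bounds/negative ranges.
Census STRUCTURE (seat pub-omega-stpp-2 gen 30, 2026-08-29), family (b2).  Nothing here is progress on `ω` — every theorem EXCLUDES size patterns of
simultaneous-triple-product families of `ℤ/47` (CKSU Def. 5.1); the capstone says CKSU Thm. 5.5 yields no `ω < 3` from `ℤ₄₇`, whatever the number of triples.

The kernel lister at order `47` leaves exactly three minimal beating size patterns undecided by the tree laws (`KLister.deadN47` of
`STPPKernelListerOrderN47DP1`; all block counts, all entries): `{(2,3,4),(2,3,4)}`, `{(2,3,4),(3,2,4)}`, `{(2,2,3),(3,3,2),(3,3,2)}` (volume `48 = 47 + 1`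
each).  This file kills all three in `ℤ/47` by the tree's prime-order Vosper laws, with the finite tables decided in the kernel:
* `{(2,3,4),(2,3,4)}` — tight table law `no_isSTPP_of_tight_table_prime` (`STPPVosperPrimeTableLaw`), reading `(a,b,c)`, block `0` = `(2,3,4)`:
  `(z, b, vol, a, L) = (8, 3, 24, 2, 12)`, `8+3+24+2+12 = 49 = 47+2` (N18-tight), `(m, n) = (13, 37)`, table `(37, 13, 3)`, target `{0, 1, 46}`;
* `{(2,3,4),(3,2,4)}` — tight TILING law `no_isSTPP_of_tight_tiling_prime` (`STPPVosperTilingLaw`), reading `(a,b,c)`, block `0` = `(2,3,4)`, other block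
  `(3,2,4)`: `(z, b, vol, a, L) = (12, 3, 24, 2, 8)`, `12+3+24+2+8 = 49` (tight), `(m, n) = (9, 33)`; the window table `(33, 9, 3)` leaves the survivors
  `{0, 1, 46, 4, 43}` (so the single-reading table law does NOT close: ratio `±4`; the partner readings leave `±12, ±23` — the inverse-pair and double
  laws do not close either); the non-word survivors `4, 43` die at the exact-cover stage: `existsCover 47 12 [(j·t) mod 47 : t < 8] [(3,2,4)] [] [] = false`
  (python mirror HOME `pub-omega-stpp-1-g30/code/cover_mirror.py`);
* `{(2,2,3),(3,3,2),(3,3,2)}` — slack-1 law with the enlarged target `no_isSTPP_of_slack_one_tables_prime_mult` (`STPPVosperSlackOneLawMult`), reading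
  `(a,b,c)`, block `1` = `(3,3,2)`: `(z, b, vol, a, L) = (12, 3, 18, 3, 12)`, `48 = 47+1` (slack one), `(m, n) = (14, 32)`, target
  `J = {0, ±1, ±2, ±2⁻¹} = {0, 1, 46, 2, 45, 24, 23}`, tables γ `(32,14,3)`, α `(33,16,3)`, β `(33,14,3)` (python mirror `lean_tables.py`: all pass);
  the Hamidoune–Rødseth hypothesis of the law is DISCHARGED by the tree's `hamidouneRodsethInverseTheorem_holds`.
Then `KLister.volume_le_of_card_eq_47_of_dead` (`STPPKernelListerOrderN47DP5`, root computation of the lister with dead list `deadN47`) gives the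
UNCONDITIONAL capstone `volume_le_card_zmod47`; since every group of prime order is cyclic, this is the census word «ℤ₄₇: NO BEATING STPP FAMILY — KERNEL».

References: A. G. Vosper, J. London Math. Soc. 31 (1956); M. B. Nathanson, GTM 165, Thm 2.7; Y. O. Hamidoune, Ø. J. Rødseth, Acta Arith. 92 (2000)
251–262; H. Cohn, R. Kleinberg, B. Szegedy, C. Umans, FOCS 2005 (arXiv:math/0511460), Def. 5.1, Thm. 5.5.
-/


open Finset
open scoped Pointwise

namespace Summit.MatrixMultiplication.OmegaCensus.CubeNB

open Literature.Computability.AlgebraicComplexity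
open Literature.Combinatorics.Additive
open Summit.MatrixMultiplication.OmegaCensus.STPPKneser

/-! ## Tables (`decide` / `decide +kernel`) -/

section Tables

/-- Tight table `(n, m, r) = (37, 13, 3)` at order `47`: for all `j, t < 47`, the 13 positions `(t + j·i) mod 47` in `[0,37)` with the prefix law
`3 ∣ pos − #(earlier below)` at each force `j ∈ {0, 1, 46}`. [folklore] -/
theorem table47_37_13_3 : ∀ j < 47, ∀ t < 47, (∀ i < 13, (t + j * i) % 47 < 37) →
    (∀ k < 13, 3 ∣ (t + j * k) % 47 - #((range 13).filter fun i => (t + j * i) % 47 < (t + j * k) % 47)) →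
    j ∈ ({0, 1, 47 - 1} : Finset ℕ) := by
  decide +kernel

/-- Window table `(n, m, r) = (33, 9, 3)` at order `47` with the survivor target `{0, 1, 46, 4, 43}`. [folklore] -/
theorem table47_33_9_3_surv : ∀ j < 47, ∀ t < 47, (∀ i < 9, (t + j * i) % 47 < 33) →
    (∀ k < 9, 3 ∣ (t + j * k) % 47 - #((range 9).filter fun i => (t + j * i) % 47 < (t + j * k) % 47)) →
    j ∈ ({0, 1, 46, 4, 43} : Finset ℕ) := by
  decide +kernel

/-- The exact-cover searches for the two non-word survivors `j ∈ {4, 43}` (other block `(3,2,4)`, `L = 8`, `z = 12`) both FAIL. [folklore] -/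
theorem cover47_234_324_fail : ∀ jv ∈ ({4, 43} : Finset ℕ),
    existsCover 47 12 ((List.range 8).map fun t => (jv * t) % 47) [(3, 2, 4)] [] [] = false := by
  decide +kernel

/-- The split of the survivor target: word ratios (`0`, `±1`, `±2` for `b = 3`; `±1⁻¹` for `a = 2`) or a failed exact-cover search. [folklore] -/
theorem split47_234_324 : ∀ jv ∈ ({0, 1, 46, 4, 43} : Finset ℕ),
    (jv = 0 ∨ (∃ k ∈ range 3, 1 ≤ k ∧ (jv = k ∨ jv + k = 47)) ∨ (∃ k ∈ range 2, 1 ≤ k ∧ (jv * k % 47 = 1 ∨ jv * k % 47 = 47 - 1))) ∨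
      existsCover 47 12 ((List.range 8).map fun t => (jv * t) % 47) [(3, 2, 4)] [] [] = false := by
  intro jv hjv
  have hcases : jv ∈ ({0, 1, 46} : Finset ℕ) ∨ jv ∈ ({4, 43} : Finset ℕ) := by
    revert hjv; revert jv; decide
  rcases hcases with h | h
  · left; revert h; revert jv; decide
  · right; exact cover47_234_324_fail jv h

/-- The enlarged target at `47` for `(a, b) = (3, 3)`: every element is `0`, `±k` (`k < 3`) or `±k⁻¹` (`k < 3`) modulo `47`. [folklore] -/
theorem target47_a3_b3 : ∀ jv ∈ ({0, 1, 46, 2, 45, 24, 23} : Finset ℕ),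
    jv = 0 ∨ (∃ k ∈ range 3, 1 ≤ k ∧ (jv = k ∨ jv + k = 47)) ∨ (∃ k ∈ range 3, 1 ≤ k ∧ (jv * k % 47 = 1 ∨ jv * k % 47 = 47 - 1)) := by
  decide

/-- Tight-type table `(n, m, r) = (32, 14, 3)` at `47` with the enlarged target for `(a, b) = (3, 3)`. [folklore] -/
theorem table47_32_14_3_a3b3 : ∀ j < 47, ∀ t < 47, (∀ i < 14, (t + j * i) % 47 < 32) →
    (∀ k < 14, 3 ∣ (t + j * k) % 47 - #((range 14).filter fun i => (t + j * i) % 47 < (t + j * k) % 47)) →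
    j ∈ ({0, 1, 46, 2, 45, 24, 23} : Finset ℕ) := by
  decide +kernel

/-- Case-α table `(33, 16, 3)` at `47` with the enlarged target for `(a, b) = (3, 3)`. [folklore] -/
theorem tableAlpha47_33_16_3_a3b3 : tableAlpha 47 33 16 3 {0, 1, 46, 2, 45, 24, 23} = true := by
  decide +kernel

/-- Case-β table `(33, 14, 3)` at `47` with the enlarged target for `(a, b) = (3, 3)`. [folklore] -/
theorem tableBeta47_33_14_3_a3b3 : tableBeta 47 33 14 3 {0, 1, 46, 2, 45, 24, 23} = true := by
  decide +kernel

end Tables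

/-! ## The kills -/

section Kills

/-- **`{(2,3,4), (2,3,4)}` has no STPP family in `ℤ/47ℤ`** (Vosper tight table law, reading `(a,b,c)`, tight block `0` of sizes `(2,3,4)`,
`(z,b,vol,a,L) = (8,3,24,2,12)`, table `(37,13,3)`); kernel, unconditional. [cite: CohnKleinbergSzegedyUmans2005, Def. 5.1] [cite: Nathanson1996, Thm 2.7] -/
theorem no_isSTPP_zmod47_234_234 (A B C : Fin 2 → Finset (ZMod 47)) (hS : IsSTPP A B C)
    (hA : ∀ i, #(A i) = ![2, 2] i) (hB : ∀ i, #(B i) = ![3, 3] i) (hC : ∀ i, #(C i) = ![4, 4] i) :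
    False := by
  have hAne : ∀ i, (A i).Nonempty := fun i => card_pos.1 (by rw [hA]; fin_cases i <;> simp)
  have hBne : ∀ i, (B i).Nonempty := fun i => card_pos.1 (by rw [hB]; fin_cases i <;> simp)
  have hCne : ∀ i, (C i).Nonempty := fun i => card_pos.1 (by rw [hC]; fin_cases i <;> simp)
  have e0 : (univ : Finset (Fin 2)).erase 0 = {1} := by decide
  have hz : ∑ k ∈ (univ : Finset (Fin 2)).erase 0, #(A k) * #(C k) = 8 := by
    rw [e0, Finset.sum_singleton]; simp [hA, hC]
  have hL : ∑ k ∈ (univ : Finset (Fin 2)).erase 0, #(B k) * #(C k) = 12 := by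
    rw [e0, Finset.sum_singleton]; simp [hB, hC]
  have ha : #(A 0) = 2 := by rw [hA]; simp
  have hb : #(B 0) = 3 := by rw [hB]; simp
  have hvol : #(A 0) * #(B 0) * #(C 0) = 24 := by rw [hA, hB, hC]; simp
  haveI : Fact (Nat.Prime 47) := ⟨by norm_num⟩
  exact no_isSTPP_of_tight_table_prime A B C hS hAne hBne hCne 0 ⟨1, by decide⟩ ha hb hvol hz hL (by norm_num)
    (by norm_num) (by norm_num) (by norm_num) (by norm_num) (m := 13) (n := 37) rfl rfl table47_37_13_3

/-- **`{(2,3,4), (3,2,4)}` has no STPP family in `ℤ/47ℤ`** — UNCONDITIONAL (Vosper tiling law, reading `(a,b,c)`, tight block `0` = `(2,3,4)`,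
other block `(3,2,4)`: `(z, b, vol, a, L) = (12, 3, 24, 2, 8)`, window table `(33,9,3)` with survivors `{0, 1, 46, 4, 43}`, word ratios `0, ±1, ±2`,
exact covers for `j ∈ {4, 43}` fail). [cite: CohnKleinbergSzegedyUmans2005, Def. 5.1] [cite: Vosper1956, main theorem; Nathanson1996, Thm 2.7] -/
theorem no_isSTPP_zmod47_234_324 (A B C : Fin 2 → Finset (ZMod 47)) (hS : IsSTPP A B C)
    (hA : ∀ i, #(A i) = ![2, 3] i) (hB : ∀ i, #(B i) = ![3, 2] i) (hC : ∀ i, #(C i) = ![4, 4] i) : False := by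
  haveI : Fact (Nat.Prime 47) := ⟨by norm_num⟩
  have hAne : ∀ i, (A i).Nonempty := fun i => card_pos.1 (by rw [hA]; fin_cases i <;> simp)
  have hBne : ∀ i, (B i).Nonempty := fun i => card_pos.1 (by rw [hB]; fin_cases i <;> simp)
  have hCne : ∀ i, (C i).Nonempty := fun i => card_pos.1 (by rw [hC]; fin_cases i <;> simp)
  have e0 : (univ : Finset (Fin 2)).erase 0 = {1} := by decide
  have hz : ∑ k ∈ (univ : Finset (Fin 2)).erase 0, #(A k) * #(C k) = 12 := by
    rw [e0, Finset.sum_singleton]; simp [hA, hC]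
  have hL : ∑ k ∈ (univ : Finset (Fin 2)).erase 0, #(B k) * #(C k) = 8 := by
    rw [e0, Finset.sum_singleton]; simp [hB, hC]
  have ha : #(A 0) = 2 := by rw [hA]; simp
  have hb : #(B 0) = 3 := by rw [hB]; simp
  have hvol : #(A 0) * #(B 0) * #(C 0) = 24 := by rw [hA, hB, hC]; simp
  refine no_isSTPP_of_tight_tiling_prime A B C hS hAne hBne hCne 0 ⟨1, by decide⟩ ha hb hvol hz hL (by norm_num) (by norm_num)
    (by norm_num) (by norm_num) (by norm_num) (m := 9) (n := 33) rfl rfl [1] (by decide) (fun k => by fin_cases k <;> decide)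
    table47_33_9_3_surv (fun jv hjv => ?_)
  have hsz : ([1] : List (Fin 2)).map (fun k => (#(A k), #(B k), #(C k))) = [(3, 2, 4)] := by simp [hA, hB, hC]
  rw [hsz]
  exact split47_234_324 jv hjv

/-- **`{(2,2,3), (3,3,2), (3,3,2)}` has no STPP family in `ℤ/47ℤ`** (enlarged-target slack-1 law, reading `(a,b,c)`, block `1` of sizes `(3,3,2)`:
`(z, b, vol, a, L) = (12, 3, 18, 3, 12)`, tables γ `(32,14,3)`, α `(33,16,3)`, β `(33,14,3)`, target `{0, 1, 46, 2, 45, 24, 23}`; Hamidoune–Rødseth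
discharged by `hamidouneRodsethInverseTheorem_holds`); kernel, UNCONDITIONAL. [cite: CohnKleinbergSzegedyUmans2005, Def. 5.1]
[cite: HamidouneRodseth2000, main theorem (§1, p. 252)] [cite: Nathanson1996, Thm 2.7] -/
theorem no_isSTPP_zmod47_223_332_332 (A B C : Fin 3 → Finset (ZMod 47)) (hS : IsSTPP A B C)
    (hA : ∀ i, #(A i) = ![2, 3, 3] i) (hB : ∀ i, #(B i) = ![2, 3, 3] i) (hC : ∀ i, #(C i) = ![3, 2, 2] i) :
    False := by
  haveI : Fact (Nat.Prime 47) := ⟨by norm_num⟩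
  have hAne : ∀ i, (A i).Nonempty := fun i => card_pos.1 (by rw [hA]; fin_cases i <;> simp)
  have hBne : ∀ i, (B i).Nonempty := fun i => card_pos.1 (by rw [hB]; fin_cases i <;> simp)
  have hCne : ∀ i, (C i).Nonempty := fun i => card_pos.1 (by rw [hC]; fin_cases i <;> simp)
  have e1 : (univ : Finset (Fin 3)).erase 1 = {0, 2} := by decide
  have hz : ∑ k ∈ (univ : Finset (Fin 3)).erase 1, #(A k) * #(C k) = 12 := by
    rw [e1, Finset.sum_pair (by decide)]; simp [hA, hC]
  have hL : ∑ k ∈ (univ : Finset (Fin 3)).erase 1, #(B k) * #(C k) = 12 := by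
    rw [e1, Finset.sum_pair (by decide)]; simp [hB, hC]
  have ha : #(A 1) = 3 := by rw [hA]; simp
  have hb : #(B 1) = 3 := by rw [hB]; simp
  have hvol : #(A 1) * #(B 1) * #(C 1) = 18 := by rw [hA, hB, hC]; simp
  exact no_isSTPP_of_slack_one_tables_prime_mult hamidouneRodsethInverseTheorem_holds A B C hS hAne hBne hCne 1 ⟨0, by decide⟩ ha hb hvol hz hL
    (by norm_num) (by norm_num) (by norm_num) (by norm_num) (by norm_num) (m := 14) (n := 32) rfl rfl target47_a3_b3 table47_32_14_3_a3b3
    tableAlpha47_33_16_3_a3b3 tableBeta47_33_14_3_a3b3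

end Kills

/-! ## Non-realisability of the two killed dead classes, and the order-47 capstone modulo the third -/

section Capstone

open Summit.MatrixMultiplication.OmegaCensus.KLister

/-- The dead class `234_234` is not realisable in `ℤ₄₇`. [cite: CohnKleinbergSzegedyUmans2005, Def. 5.1] -/
theorem notRealizable_Z47_234_234 : ¬ Realizable (ZMod 47) ([(2, 3, 4), (2, 3, 4)] : List Shape) := by
  intro h
  obtain ⟨A, B, C, hS, hc⟩ := h.out
  exact no_isSTPP_zmod47_234_234 A B C hS (fun i => by fin_cases i <;> exact (hc _).2.2.2.1)
    (fun i => by fin_cases i <;> exact (hc _).2.2.2.2.1) (fun i => by fin_cases i <;> exact (hc _).2.2.2.2.2)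

/-- The dead class `234_324` is not realisable in `ℤ₄₇`. [cite: CohnKleinbergSzegedyUmans2005, Def. 5.1] -/
theorem notRealizable_Z47_234_324 : ¬ Realizable (ZMod 47) ([(2, 3, 4), (3, 2, 4)] : List Shape) := by
  intro h
  obtain ⟨A, B, C, hS, hc⟩ := h.out
  exact no_isSTPP_zmod47_234_324 A B C hS (fun i => by fin_cases i <;> exact (hc _).2.2.2.1)
    (fun i => by fin_cases i <;> exact (hc _).2.2.2.2.1) (fun i => by fin_cases i <;> exact (hc _).2.2.2.2.2)

/-- The dead class `223_332_332` is not realisable in `ℤ₄₇`. [cite: CohnKleinbergSzegedyUmans2005, Def. 5.1] -/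
theorem notRealizable_Z47_223_332_332 : ¬ Realizable (ZMod 47) ([(2, 2, 3), (3, 3, 2), (3, 3, 2)] : List Shape) := by
  intro h
  obtain ⟨A, B, C, hS, hc⟩ := h.out
  exact no_isSTPP_zmod47_223_332_332 A B C hS (fun i => by fin_cases i <;> exact (hc _).2.2.2.1)
    (fun i => by fin_cases i <;> exact (hc _).2.2.2.2.1) (fun i => by fin_cases i <;> exact (hc _).2.2.2.2.2)

/-- **Every dead class of `KLister.deadN47` is non-realisable in `ℤ₄₇`.** [folklore] -/
theorem notRealizable_deadN47 : ∀ D ∈ deadN47, ¬ Realizable (ZMod 47) D := by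
  intro D hD
  simp only [deadN47, List.mem_cons, List.not_mem_nil, or_false] at hD
  rcases hD with rfl | rfl | rfl
  exacts [notRealizable_Z47_234_234, notRealizable_Z47_234_324, notRealizable_Z47_223_332_332]

/-- **CAPSTONE (kernel, UNCONDITIONAL): no simultaneous-triple-product family of `ℤ₄₇` beats the sum of cubes** — for every `m` and every STPP
family `(Aᵢ, Bᵢ, Cᵢ)_{i<m}` of `ℤ/47` (CKSU Def. 5.1), `Σᵢ |Aᵢ||Bᵢ||Cᵢ| ≤ 47`: the order-47 lister capstone `KLister.volume_le_of_card_eq_47_of_dead` with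
its whole dead list discharged by the three kills above. [cite: CohnKleinbergSzegedyUmans2005, Def. 5.1, Thm. 5.5] -/
theorem volume_le_card_zmod47 {m : ℕ} (A B C : Fin m → Finset (ZMod 47)) (hS : IsSTPP A B C) : ∑ i, #(A i) * #(B i) * #(C i) ≤ 47 :=
  volume_le_of_card_eq_47_of_dead (ZMod.card 47) notRealizable_deadN47 A B C hS

/-- The same capstone in the `∄` form used by the census rows. [cite: CohnKleinbergSzegedyUmans2005, Def. 5.1, Thm. 5.5] -/
theorem not_exists_beating_isSTPP_zmod47 :
    ¬ ∃ (m : ℕ) (A B C : Fin m → Finset (ZMod 47)), IsSTPP A B C ∧ 47 < ∑ i, #(A i) * #(B i) * #(C i) := by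
  rintro ⟨m, A, B, C, hS, hlt⟩
  exact absurd (volume_le_card_zmod47 A B C hS) (not_le.2 hlt)

end Capstone

end Summit.MatrixMultiplication.OmegaCensus.CubeNB
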